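import Summits.QuantumFields.YangMills.Theorems.BalabanUVNodesN15TwoGridGluingGeneralTransport
import Summits.QuantumFields.YangMills.Theorems.BalabanUVNodesN15PerCubeGreenCovDDictionary
import Summits.QuantumFields.YangMills.Theorems.BalabanUVNodesN15TwoSpacingGluingCubes
import HarnessLib

/-!
# N15 = NE2, road (c) — PROGRAMME (PC), (PC-E-J) GROUNDWORK: THE TWO-GRID η-DEFECT OF A COVARIANT-DERIVATIVE PIECE `D_V∘Y` THROUGH A GENERAL TRANSPORT, FROM FLAT JET DATA —
# `D_V = ∇ + M_{n(R−1)}∘τ_e^*` (n15-c∕270's species split) ⟹ `𝔇_τ(D′_{V′}∘Y′, D_V∘Y) = 𝔇_τ(∇′Y′, ∇Y) + M_{a′}∘𝔇_τ(τ_{e′}^*Y′, τ_e^*Y) + 𝔇_τ(M_{a′}, M_a)∘τ_e^*Y`, and the GAUGE LAW for a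
# conjugated piece `D_U∘(M_{Wᵀ}YM_{W₁}) = M_{Wᵀ}∘(D_{U^W}∘Y)∘M_{W₁}` — the per-piece inputs of n15-c∕399's `hIDGc` in the (PC-E) cube gauges (dag-n15-c g35, n15-c∕400)

Cell `pub-ymgap`, seat `pub-ymgap-dag-n15-c` (generation g35; R134 (a) seat, strategy s1 «first missing estimate»; HUMAN RULING D-0062; chair R424 venue).
`bears_on: R4∕N15 · K3⁸ SpineGivenEndpointR13SepCoPHV (stmt-QuantumFields-27366)`; filed `--kind proof --supports stmt-QuantumFields-27366 --as helper` — COUNT-NEUTRAL.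
FOUR theorems, 0 `def`, 0 `sorry`; [folklore] algebra + block-norm bookkeeping.  Imports BY NAME n15-c∕332 `…TwoGridGluingGeneralTransport` (`idef` algebra through `τ`), n15-c∕270
`…PerCubeGreenCovDDictionary` (`covD_eq_fgrad_add` = the species split, `covD_comp_mmulOp_transpose` = the gauge law), n15-c FILE 32 `…TwoSpacingGluingCubes` (`hasMaj_diag_comp`,
`hasMaj_comp_diag`); n15-w2∕n15-b `covD`, `mmulOp`, `fgrad`, `pull`, `liftEquiv`, `hasMaj_mmulOp`.  Nothing in the tree is modified, no landed name re-declared.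

WHY (PCJ-DESIGN-g35.md §2, row «flat jet rows of `Z_k = D_VY`»).  In the (PC-E) glue the pieces are `M_{W_kᵀ}X_kM_{W_k}` (dressed cube `X_k` in the cube gauge `W_k`); the gradient entry
puts `D_U` in front; by the gauge law the derivative moves INSIDE the conjugation as `D_{V_k}`, `V_k = U^{w_k}` the SMALL cube-gauged field; its species split `D_V = ∇ + M_a∘τ_e^*`
(`a = η⁻¹(R_V − 1)`, `|a| ≲ C∕ξ`) reduces the two-grid defect of `D_{V_k}X_k` to: the flat jet defect `𝔇(∇′X′_k, ∇X_k)` (dag-n15-w3's dressed-cube jets), the shift defect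
`𝔇(τ_{e′}^*X′_k, τ_e^*X_k)` (`= O(η)·∇X_k`, g8 `hasMaj_idefShift_comp` pattern), and the coefficient defect `𝔇(M_{a′}, M_a)` (the species fit of the PAIRING, n15-c∕343's letter).

CONTENTS.
* §1 `covD_comp_eq_fgrad_add` (`D_V∘Y = ∇∘Y + M_a∘(τ_e^*∘Y)`); `covD_comp_conj_eq` (the gauge law for a conjugated piece, from 270).
* §2 ★★ `hasMaj_idef_covD_comp_tr` — the two-grid defect of `D_V∘Y` through ANY `τ` (§3, v1.1: `…_gtr` ∕ `…_loc_gtr` with DISTINCT source spaces on the two grids; §4, v1.2: `hasMaj_covD_comp_of_rows`, `hasMaj_idef_shift_comp_of_rows`) from: the flat jet defect row (kernel `K₁`), the shift-defect row (`K₂`), the coarse shifted row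
  the fine coefficient letter (`Σ_j|a′_{ij}| ≤ c_a`) and the coefficient-defect row (`diag o_a`): `≤ K₁ + c_a·K₂ + o_a·K₃`; ★★ `hasMaj_idef_covD_comp_loc_tr` — the same in
  n15-c∕399's localized currency `1_S1_S·(m₁ + c_am_S + o_aβ_S)·e^{−δd}`.

HONEST FRAMING ∕ LIMITS.  Generic bookkeeping; the jet∕shift∕coefficient rows are HYPOTHESES (their (PC-E) producers: dag-n15-w3 34∕35, g8's shift lemma, 343 — to be assembled in the
successor's cube-level file 334J).  Nothing of [B9] asserted; NE2⁺ NOT PRINTED ∕ NOT proved; N15 of record untouched (DISCHARGED AS CONSUMED, p687738); K3⁸ OPEN; counts of record UNMOVED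
(typed 28∕28 · discharged 8∕27); one finite 𝕋⁴ at fixed ε per index — NOT infinite volume, NOT OS on ℝ⁴, NOT a mass gap, NOT Clay.  Restate-immune (no Theses import).
-/

noncomputable section
open scoped BigOperators Matrix
open Finset

namespace Summit.QuantumFields.YangMills.BalabanUVNodes.N15.Gluing

open Literature.MathematicalPhysics.QuantumFieldTheory.Balaban1983to89
open Literature.MathematicalPhysics.QuantumFieldTheory.Balaban1983to89.B11SectG (BlockNorm HasMaj hasMaj_comp)
open Literature.MathematicalPhysics.QuantumFieldTheory.Balaban1983to89.T4EtaRateDefect (idef idef_apply idef_comp idef_add)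
open Literature.MathematicalPhysics.QuantumFieldTheory.Balaban1983to89.T4EtaRateCoeffDefect (pull pull_apply diagK diagK_nonneg)
open Literature.MathematicalPhysics.QuantumFieldTheory.Balaban1983to89.B6Prop26Gluing (mulOp ind ind_nonneg)
open Summit.QuantumFields.YangMills.BalabanUVNodes.N15.MatrixSpecies (mmulOp mmulOp_apply liftMap liftBlk liftEquiv covD hasMaj_mmulOp)
open Summit.QuantumFields.YangMills.BalabanUVNodes.N15.BackgroundLayer (fgrad)

/-! ## §1 Algebra: the species split after an operator, the gauge law for a conjugated piece -/

section Algebra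

variable {X ι : Type} [Fintype ι] [DecidableEq ι]

/-- `D_V∘Y = ∇∘Y + M_{n(R−1)}∘(τ_e^*∘Y)` (n15-c∕270 `covD_eq_fgrad_add` after an operator). [cite: Balaban1985BackgroundPropagators, (3.50) p.400, (3.23) p.394 (shape)] -/
theorem covD_comp_eq_fgrad_add {F : Type} [AddCommGroup F] [Module ℝ F] (n : ℝ) (R : X → Matrix ι ι ℝ) (e : X ≃ X) (Y : F →ₗ[ℝ] (X × ι → ℝ)) :
    covD n⁻¹ R e ∘ₗ Y = fgrad n (liftEquiv e ι) ∘ₗ Y + mmulOp (fun x => n • (R x - 1)) ∘ₗ (pull (liftEquiv e ι) ∘ₗ Y) := by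
  rw [covD_eq_fgrad_add, LinearMap.add_comp, LinearMap.comp_assoc]

/-- ★ **THE GAUGE LAW FOR A CONJUGATED PIECE**: `D_U∘(M_{Wᵀ}∘Y∘M_{W₁}) = M_{Wᵀ}∘(D_{U^W}∘Y)∘M_{W₁}`, `R^W(x) = W(x)R(x)W(sx)ᵀ`, `WᵀW = 1` — the left factor of the gradient entry moves
INSIDE the cube-gauge conjugation (n15-c∕270 `covD_comp_mmulOp_transpose`), so that n15-c∕333's per-piece twisted conversion applies to the piece `D_{U^W}∘Y`.
[cite: Balaban1985BackgroundPropagators, (3.34)–(3.35) p.396, (3.50) p.400 (shape)] -/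
theorem covD_comp_conj_eq {F : Type} [AddCommGroup F] [Module ℝ F] {W : X → Matrix ι ι ℝ} (hW' : ∀ x, (W x)ᵀ * W x = 1) (η : ℝ) (R : X → Matrix ι ι ℝ) (s : X → X)
    (Y : (X × ι → ℝ) →ₗ[ℝ] (X × ι → ℝ)) (M₁ : F →ₗ[ℝ] (X × ι → ℝ)) :
    covD η R s ∘ₗ (mmulOp (fun x => (W x)ᵀ) ∘ₗ Y ∘ₗ M₁) = mmulOp (fun x => (W x)ᵀ) ∘ₗ (covD η (fun x => W x * R x * (W (s x))ᵀ) s ∘ₗ Y) ∘ₗ M₁ := by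
  rw [← LinearMap.comp_assoc, ← LinearMap.comp_assoc, covD_comp_mmulOp_transpose hW']
  simp only [LinearMap.comp_assoc]

end Algebra

/-! ## §2 The two-grid defect of `D_V∘Y` through a general transport from flat jet data -/

section Defect

variable {X X' : Type} [Fintype X] [Fintype X'] {ι : Type} [Fintype ι] [DecidableEq ι] {g : B6.Geometry} (blk : X → g.Site) (π : X' → X)
  {F : Type} [AddCommGroup F] [Module ℝ F] (b₁ : BlockNorm g F) (τ₁ : F →ₗ[ℝ] F) (τ : (X × ι → ℝ) →ₗ[ℝ] (X' × ι → ℝ))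

/-- ★★ **THE TWO-GRID η-DEFECT OF `D_V∘Y` THROUGH ANY TRANSPORTS** (`τ₁` on the source, `τ` on the site-function target): from the flat jet defect `𝔇(∇′∘Y′, ∇∘Y) ≤ K₁`, the shift defect
`𝔇(τ_{e′}^*∘Y′, τ_e^*∘Y) ≤ K₂`, the coarse shifted row `τ_e^*∘Y ≤ K₃`, the fine coefficient letter `Σ_j|(n′(R′−1))_{ij}| ≤ c_a` and the coefficient-defect row
`𝔇_τ(M_{n′(R′−1)}, M_{n(R−1)}) ≤ diag o_a`:  `𝔇(D′_{V′}∘Y′, D_V∘Y) ≤ K₁ + c_a·K₂ + o_a·K₃`. [cite: Balaban1985BackgroundPropagators, (3.50) p.400 (species), Thm 3.14 pp.426–427 (difference template)] -/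
theorem hasMaj_idef_covD_comp_tr {n n' : ℝ} {R : X → Matrix ι ι ℝ} {R' : X' → Matrix ι ι ℝ} (e : X ≃ X) (e' : X' ≃ X') {Y : F →ₗ[ℝ] (X × ι → ℝ)} {Y' : F →ₗ[ℝ] (X' × ι → ℝ)}
    {K₁ K₂ K₃ : g.Site → g.Site → ℝ} {ca oa : ℝ} (hca : 0 ≤ ca) (hoa : 0 ≤ oa)
    (ha' : ∀ x' i, ∑ j, |(n' • (R' x' - 1)) i j| ≤ ca)
    (hDa : HasMaj (BlockNorm.ofBlocks g (liftBlk blk ι)) (BlockNorm.ofBlocks g (liftBlk (blk ∘ π) ι)) (idef τ τ (mmulOp fun x' => n' • (R' x' - 1)) (mmulOp fun x => n • (R x - 1))) (diagK fun _ => oa))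
    (hJ : HasMaj b₁ (BlockNorm.ofBlocks g (liftBlk (blk ∘ π) ι)) (idef τ₁ τ (fgrad n' (liftEquiv e' ι) ∘ₗ Y') (fgrad n (liftEquiv e ι) ∘ₗ Y)) K₁)
    (hDS : HasMaj b₁ (BlockNorm.ofBlocks g (liftBlk (blk ∘ π) ι)) (idef τ₁ τ (pull (liftEquiv e' ι) ∘ₗ Y') (pull (liftEquiv e ι) ∘ₗ Y)) K₂)
    (hSY : HasMaj b₁ (BlockNorm.ofBlocks g (liftBlk blk ι)) (pull (liftEquiv e ι) ∘ₗ Y) K₃) :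
    HasMaj b₁ (BlockNorm.ofBlocks g (liftBlk (blk ∘ π) ι)) (idef τ₁ τ (covD n'⁻¹ R' e' ∘ₗ Y') (covD n⁻¹ R e ∘ₗ Y)) (fun y y' => K₁ y y' + ca * K₂ y y' + oa * K₃ y y') := by
  have hMa' := hasMaj_mmulOp (g := g) (blk ∘ π) (m := fun _ => ca) (fun _ => hca) ha'
  -- term 2: `M_{a′} ∘ 𝔇(τ_{e′}^*Y′, τ_e^*Y)`; term 3: `𝔇(M_{a′}, M_a) ∘ (τ_e^*Y)`
  have t2 := hasMaj_diag_comp (liftBlk (blk ∘ π) ι) (fun _ => hca) hMa' hDS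
  have t3 := hasMaj_diag_comp (liftBlk blk ι) (fun _ => hoa) hDa hSY
  rw [covD_comp_eq_fgrad_add, covD_comp_eq_fgrad_add, idef_add,
    idef_comp τ₁ τ τ (mmulOp fun x' => n' • (R' x' - 1)) (pull (liftEquiv e' ι) ∘ₗ Y') (mmulOp fun x => n • (R x - 1)) (pull (liftEquiv e ι) ∘ₗ Y)]
  refine (hJ.add (t2.add t3)).mono fun y y' => le_of_eq ?_
  ring

/-- ★★ **… IN n15-c∕399's LOCALIZED CURRENCY**: jet defect `1_S1_S·m₁e^{−δd}`, shift defect `1_S1_S·m_Se^{−δd}`, shifted row `1_S1_S·β_Se^{−δd}` ⟹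
`𝔇(D′_{V′}∘Y′, D_V∘Y) ≤ 1_S1_S·(m₁ + c_a·m_S + o_a·β_S)·e^{−δd}` — the shape of 399's `hIDGc`. [cite: Balaban1985BackgroundPropagators, (3.50) p.400, Thm 3.14 pp.426–427 (template)] -/
theorem hasMaj_idef_covD_comp_loc_tr {n n' : ℝ} {R : X → Matrix ι ι ℝ} {R' : X' → Matrix ι ι ℝ} (e : X ≃ X) (e' : X' ≃ X') {Y : F →ₗ[ℝ] (X × ι → ℝ)} {Y' : F →ₗ[ℝ] (X' × ι → ℝ)}
    {Sc : Set g.Site} {ca oa m₁ mS βS δ : ℝ} (hca : 0 ≤ ca) (hoa : 0 ≤ oa)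
    (ha' : ∀ x' i, ∑ j, |(n' • (R' x' - 1)) i j| ≤ ca)
    (hDa : HasMaj (BlockNorm.ofBlocks g (liftBlk blk ι)) (BlockNorm.ofBlocks g (liftBlk (blk ∘ π) ι)) (idef τ τ (mmulOp fun x' => n' • (R' x' - 1)) (mmulOp fun x => n • (R x - 1))) (diagK fun _ => oa))
    (hJ : HasMaj b₁ (BlockNorm.ofBlocks g (liftBlk (blk ∘ π) ι)) (idef τ₁ τ (fgrad n' (liftEquiv e' ι) ∘ₗ Y') (fgrad n (liftEquiv e ι) ∘ₗ Y))
      (fun y y' => ind Sc y * ind Sc y' * (m₁ * Real.exp (-(δ * g.dist y y')))))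
    (hDS : HasMaj b₁ (BlockNorm.ofBlocks g (liftBlk (blk ∘ π) ι)) (idef τ₁ τ (pull (liftEquiv e' ι) ∘ₗ Y') (pull (liftEquiv e ι) ∘ₗ Y))
      (fun y y' => ind Sc y * ind Sc y' * (mS * Real.exp (-(δ * g.dist y y')))))
    (hSY : HasMaj b₁ (BlockNorm.ofBlocks g (liftBlk blk ι)) (pull (liftEquiv e ι) ∘ₗ Y) (fun y y' => ind Sc y * ind Sc y' * (βS * Real.exp (-(δ * g.dist y y'))))) :
    HasMaj b₁ (BlockNorm.ofBlocks g (liftBlk (blk ∘ π) ι)) (idef τ₁ τ (covD n'⁻¹ R' e' ∘ₗ Y') (covD n⁻¹ R e ∘ₗ Y))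
      (fun y y' => ind Sc y * ind Sc y' * ((m₁ + ca * mS + oa * βS) * Real.exp (-(δ * g.dist y y')))) := by
  refine (hasMaj_idef_covD_comp_tr blk π b₁ τ₁ τ e e' hca hoa ha' hDa hJ hDS hSY).mono fun y y' => le_of_eq ?_
  ring

end Defect

/-! ## §3 (v1.1, dag-n15-c g35) The same with DISTINCT source spaces on the two grids — the form the dressed cubes need (`X_□ : (X×κ→ℝ)→(X×κ→ℝ)`, `X′_□` on the fine carrier) -/

section DefectTwoSources

variable {X X' : Type} [Fintype X] [Fintype X'] {ι : Type} [Fintype ι] [DecidableEq ι] {g : B6.Geometry} (blk : X → g.Site) (π : X' → X)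
  {F F' : Type} [AddCommGroup F] [Module ℝ F] [AddCommGroup F'] [Module ℝ F'] (b₁ : BlockNorm g F) (τ₁ : F →ₗ[ℝ] F') (τ : (X × ι → ℝ) →ₗ[ℝ] (X' × ι → ℝ))

/-- ★★ `hasMaj_idef_covD_comp_tr` with DISTINCT source spaces (`Y : F → …` coarse, `Y′ : F′ → …` fine, source transport `τ₁ : F → F′`) — v1.1. [cite: Balaban1985BackgroundPropagators, (3.50) p.400 (species), Thm 3.14 pp.426–427 (difference template)] -/
theorem hasMaj_idef_covD_comp_gtr {n n' : ℝ} {R : X → Matrix ι ι ℝ} {R' : X' → Matrix ι ι ℝ} (e : X ≃ X) (e' : X' ≃ X') {Y : F →ₗ[ℝ] (X × ι → ℝ)} {Y' : F' →ₗ[ℝ] (X' × ι → ℝ)}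
    {K₁ K₂ K₃ : g.Site → g.Site → ℝ} {ca oa : ℝ} (hca : 0 ≤ ca) (hoa : 0 ≤ oa)
    (ha' : ∀ x' i, ∑ j, |(n' • (R' x' - 1)) i j| ≤ ca)
    (hDa : HasMaj (BlockNorm.ofBlocks g (liftBlk blk ι)) (BlockNorm.ofBlocks g (liftBlk (blk ∘ π) ι)) (idef τ τ (mmulOp fun x' => n' • (R' x' - 1)) (mmulOp fun x => n • (R x - 1))) (diagK fun _ => oa))
    (hJ : HasMaj b₁ (BlockNorm.ofBlocks g (liftBlk (blk ∘ π) ι)) (idef τ₁ τ (fgrad n' (liftEquiv e' ι) ∘ₗ Y') (fgrad n (liftEquiv e ι) ∘ₗ Y)) K₁)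
    (hDS : HasMaj b₁ (BlockNorm.ofBlocks g (liftBlk (blk ∘ π) ι)) (idef τ₁ τ (pull (liftEquiv e' ι) ∘ₗ Y') (pull (liftEquiv e ι) ∘ₗ Y)) K₂)
    (hSY : HasMaj b₁ (BlockNorm.ofBlocks g (liftBlk blk ι)) (pull (liftEquiv e ι) ∘ₗ Y) K₃) :
    HasMaj b₁ (BlockNorm.ofBlocks g (liftBlk (blk ∘ π) ι)) (idef τ₁ τ (covD n'⁻¹ R' e' ∘ₗ Y') (covD n⁻¹ R e ∘ₗ Y)) (fun y y' => K₁ y y' + ca * K₂ y y' + oa * K₃ y y') := by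
  have hMa' := hasMaj_mmulOp (g := g) (blk ∘ π) (m := fun _ => ca) (fun _ => hca) ha'
  have t2 := hasMaj_diag_comp (liftBlk (blk ∘ π) ι) (fun _ => hca) hMa' hDS
  have t3 := hasMaj_diag_comp (liftBlk blk ι) (fun _ => hoa) hDa hSY
  rw [covD_comp_eq_fgrad_add, covD_comp_eq_fgrad_add, idef_add,
    idef_comp τ₁ τ τ (mmulOp fun x' => n' • (R' x' - 1)) (pull (liftEquiv e' ι) ∘ₗ Y') (mmulOp fun x => n • (R x - 1)) (pull (liftEquiv e ι) ∘ₗ Y)]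
  refine (hJ.add (t2.add t3)).mono fun y y' => le_of_eq ?_
  ring

/-- ★★ `hasMaj_idef_covD_comp_loc_tr` with DISTINCT source spaces — v1.1 (n15-c∕399's `hIDGc` currency). [cite: Balaban1985BackgroundPropagators, (3.50) p.400, Thm 3.14 pp.426–427 (template)] -/
theorem hasMaj_idef_covD_comp_loc_gtr {n n' : ℝ} {R : X → Matrix ι ι ℝ} {R' : X' → Matrix ι ι ℝ} (e : X ≃ X) (e' : X' ≃ X') {Y : F →ₗ[ℝ] (X × ι → ℝ)} {Y' : F' →ₗ[ℝ] (X' × ι → ℝ)}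
    {Sc : Set g.Site} {ca oa m₁ mS βS δ : ℝ} (hca : 0 ≤ ca) (hoa : 0 ≤ oa)
    (ha' : ∀ x' i, ∑ j, |(n' • (R' x' - 1)) i j| ≤ ca)
    (hDa : HasMaj (BlockNorm.ofBlocks g (liftBlk blk ι)) (BlockNorm.ofBlocks g (liftBlk (blk ∘ π) ι)) (idef τ τ (mmulOp fun x' => n' • (R' x' - 1)) (mmulOp fun x => n • (R x - 1))) (diagK fun _ => oa))
    (hJ : HasMaj b₁ (BlockNorm.ofBlocks g (liftBlk (blk ∘ π) ι)) (idef τ₁ τ (fgrad n' (liftEquiv e' ι) ∘ₗ Y') (fgrad n (liftEquiv e ι) ∘ₗ Y))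
      (fun y y' => ind Sc y * ind Sc y' * (m₁ * Real.exp (-(δ * g.dist y y')))))
    (hDS : HasMaj b₁ (BlockNorm.ofBlocks g (liftBlk (blk ∘ π) ι)) (idef τ₁ τ (pull (liftEquiv e' ι) ∘ₗ Y') (pull (liftEquiv e ι) ∘ₗ Y))
      (fun y y' => ind Sc y * ind Sc y' * (mS * Real.exp (-(δ * g.dist y y')))))
    (hSY : HasMaj b₁ (BlockNorm.ofBlocks g (liftBlk blk ι)) (pull (liftEquiv e ι) ∘ₗ Y) (fun y y' => ind Sc y * ind Sc y' * (βS * Real.exp (-(δ * g.dist y y'))))) :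
    HasMaj b₁ (BlockNorm.ofBlocks g (liftBlk (blk ∘ π) ι)) (idef τ₁ τ (covD n'⁻¹ R' e' ∘ₗ Y') (covD n⁻¹ R e ∘ₗ Y))
      (fun y y' => ind Sc y * ind Sc y' * ((m₁ + ca * mS + oa * βS) * Real.exp (-(δ * g.dist y y')))) := by
  refine (hasMaj_idef_covD_comp_gtr blk π b₁ τ₁ τ e e' hca hoa ha' hDa hJ hDS hSY).mono fun y y' => le_of_eq ?_
  ring

end DefectTwoSources

/-! ## §4 (v1.2, dag-n15-c g35) The remaining generic rows of the pipeline «flat jet data ⟹ `hIDGc`»: the one-grid row of `D_V∘Y`, and the shift defect of `τ_e^*∘Y` from `𝔇(Y′,Y)` -/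

section Rows

variable {X X' : Type} [Fintype X] [Fintype X'] {ι : Type} [Fintype ι] [DecidableEq ι] {g : B6.Geometry} (blk : X → g.Site) (π : X' → X)
  {F F' : Type} [AddCommGroup F] [Module ℝ F] [AddCommGroup F'] [Module ℝ F'] (b₁ : BlockNorm g F) (τ₁ : F →ₗ[ℝ] F') (τ : (X × ι → ℝ) →ₗ[ℝ] (X' × ι → ℝ))

/-- ★ **THE ONE-GRID ROW OF `D_V∘Y`** from the flat jet row `∇∘Y ≤ K₁`, the shifted row `τ_e^*∘Y ≤ K₂` and the coefficient letter `Σ_j|(n(R−1))_{ij}| ≤ c_a`: `D_V∘Y ≤ K₁ + c_a·K₂`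
(n15-c∕399's `hDGc`∕`hDGc′` from dag-n15-w3's dressed-cube jet rows). [cite: Balaban1985BackgroundPropagators, (3.50) p.400 (species: shape)] -/
theorem hasMaj_covD_comp_of_rows {n : ℝ} {R : X → Matrix ι ι ℝ} (e : X ≃ X) {Y : F →ₗ[ℝ] (X × ι → ℝ)} {K₁ K₂ : g.Site → g.Site → ℝ} {ca : ℝ} (hca : 0 ≤ ca)
    (ha : ∀ x i, ∑ j, |(n • (R x - 1)) i j| ≤ ca)
    (hJ : HasMaj b₁ (BlockNorm.ofBlocks g (liftBlk blk ι)) (fgrad n (liftEquiv e ι) ∘ₗ Y) K₁)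
    (hS : HasMaj b₁ (BlockNorm.ofBlocks g (liftBlk blk ι)) (pull (liftEquiv e ι) ∘ₗ Y) K₂) :
    HasMaj b₁ (BlockNorm.ofBlocks g (liftBlk blk ι)) (covD n⁻¹ R e ∘ₗ Y) (fun y y' => K₁ y y' + ca * K₂ y y') := by
  have hMa := hasMaj_mmulOp (g := g) blk (m := fun _ => ca) (fun _ => hca) ha
  rw [covD_comp_eq_fgrad_add]
  exact (hJ.add (hasMaj_diag_comp (liftBlk blk ι) (fun _ => hca) hMa hS)).mono fun y y' => le_rfl

omit [Fintype X] [DecidableEq ι] in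
/-- ★ **THE SHIFT DEFECT AFTER AN OPERATOR** from the operator's own defect and the displayed shift-defect row: `𝔇(τ_{e′}^*∘Y′, τ_e^*∘Y) = τ_{e′}^*∘𝔇(Y′,Y) + 𝔇(τ_{e′}^*, τ_e^*)∘Y` —
given `τ_{e′}^*∘𝔇(Y′,Y) ≤ K₁` (the operator defect read one fine step away: `hasMaj_pull_comp`) and `𝔇(τ_{e′}^*, τ_e^*)∘Y ≤ K₂` (dag-n15-e∕g8's shift-defect rows: `O(η)·∇Y` on King's
blocks), `≤ K₁ + K₂` (n15-c∕399∕401's `hDS`). [folklore] -/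
theorem hasMaj_idef_shift_comp_of_rows (e : X ≃ X) (e' : X' ≃ X') {Y : F →ₗ[ℝ] (X × ι → ℝ)} {Y' : F' →ₗ[ℝ] (X' × ι → ℝ)} {K₁ K₂ : g.Site → g.Site → ℝ}
    (h1 : HasMaj b₁ (BlockNorm.ofBlocks g (liftBlk (blk ∘ π) ι)) (pull (liftEquiv e' ι) ∘ₗ idef τ₁ τ Y' Y) K₁)
    (h2 : HasMaj b₁ (BlockNorm.ofBlocks g (liftBlk (blk ∘ π) ι)) (idef τ τ (pull (liftEquiv e' ι)) (pull (liftEquiv e ι)) ∘ₗ Y) K₂) :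
    HasMaj b₁ (BlockNorm.ofBlocks g (liftBlk (blk ∘ π) ι)) (idef τ₁ τ (pull (liftEquiv e' ι) ∘ₗ Y') (pull (liftEquiv e ι) ∘ₗ Y)) (fun y y' => K₁ y y' + K₂ y y') := by
  rw [idef_comp τ₁ τ τ]
  exact h1.add h2

end Rows

end Summit.QuantumFields.YangMills.BalabanUVNodes.N15.Gluing

end
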